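import Literature.NumberTheory.LFunctions.Zhang2022.KnifeEdgeWallCross
import Mathlib.LinearAlgebra.Matrix.PosDef
import Mathlib.Analysis.Complex.Order

/-!
# Zhang (2022), rung F-S3 (Landau–Siegel programme, family B-multi, every class with `k` displayed blocks): the
# GRAM MATRIX of the discrete form on a finite family of value tables is positive semidefinite at EVERY modulus —
# the discrete-level certificate `GramPSD_k` behind the k-block (B1) slot, PROVED; nothing asserted

Y. Zhang, *Discrete mean estimates and the Landau–Siegel zero*, arXiv:2211.02515v1 [Zhang2022LandauSiegel] —
an unrefereed manuscript under adjudication. **WHAT THIS IS NOT: not a claim about Theorems 1–2 of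
arXiv:2211.02515, about Landau–Siegel zeros, or about Parity. Every declaration below is finite-sum algebra about
Zhang's discrete mean `Ξ` ((2.16)–(2.17), in the real-weight form `KnifeEdge.discMean` / `KnifeEdge.discPolar` of
`KnifeEdgeEStarLen.lean` / `KnifeEdgeWallCross.lean`), valid at EVERY modulus `D` and every real primitive `χ`;
no asymptotics, no (A), no slot. The programme SEARCHES and TYPES.**

**Why (cell bookkeeping).** A B-multi design with `k` pieces (bulk `u`, interior jumps, a wall band, Λ-type blocks …;
B-multi/PLAN.md v1.1 §9.1, KILL-draft v1.4 §4 row `GramPSD_k`) has value table `Σ_i x_i H_i` (amplitudes `x_i`,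
piece tables `H_i`), so its discrete mean is the Hermitian form `x ↦ Σ_{i,j} x_i conj(x_j) Ξ(H_i,H_j)` of the GRAM
MATRIX `G = (Ξ(H_i,H_j))_{i,j}` (`discMean_tableComb`). With the weights `Re 𝔠*(ρ,ψ)·Re ω(ρ) ≥ 0` (Lemma 2.3 +
Prop. 2.2 (i), `KnifeEdge.weights_nonneg_of`) that form is `Σ_ρ w_ρ |Σ_i x_i H_i(ρ)|² ≥ 0`: **`G` is PSD at every
modulus** (`discGram_posSemidef`, Mathlib's `Matrix.PosSemidef`; elementary form `discGram_quadForm_nonneg`). For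
`k = 2` this is the weighted Cauchy–Schwarz inequality `|Ξ(F,G)|² ≤ Ξ(F)Ξ(G)` of `KnifeEdgeWallCross.norm_sq_discPolar_le`;
for `k ≥ 3` pairwise Cauchy–Schwarz is NOT enough (ls-B-ref-1 W-1, 17:38:07Z) and the full Gram statement is what an
honest family of (A)-world main-term constants `(M_{ij})` must inherit: any displayed k-block slot of the shape «the
main-term matrix is PSD» is, at the discrete level, a THEOREM — so a design can read «closes at main order» only if
its dictionary main terms are NOT the limits of the discrete form under (A), or (A) fails (cf.
`KnifeEdgeWallCross.theorem1_of_crossNegDiscrete` for the wall class).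

**Contents.** Part 1: `discPolar_conj_symm` (Hermitian symmetry), `discPolar_self` (`Ξ(F,F) = Ξ(F)` as a complex
number), `tableComb x H = Σ_i x_i H_i`, `discPolar_tableComb` (finite sesquilinearity, ONE statement:
`Ξ(Σ x_i H_i, Σ y_j K_j) = Σ_i Σ_j x_i conj(y_j) Ξ(H_i,K_j)`), `discMean_tableComb` («member OBJ = x†Gx»). Part 2:
`discGram`, `discGram_isHermitian`, `star_dotProduct_discGram_mulVec` (`x†Gx = Ξ(T,T)`, `T = Σ conj(x_i) H_i`),
`discGram_quadForm_nonneg`, `discGram_posSemidef`, and the member corollary `discMean_tableComb_nonneg`.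
Binary `add/smul` forms, the block-polynomial splits and the slot compositions are ls-knife-typer-1's
`KnifeEdgeSlotCalculus.lean` (coordination INBOX 17:42:44Z / 18:0xZ); the wall-class instance is `KnifeEdgeWallCross`.
References: Zhang, arXiv:2211.02515v1, §2 (2.14)–(2.17), Lemma 2.3, Prop. 2.2 (i) [cite: Zhang2022LandauSiegel, §2
(2.16)–(2.17), Lemma 2.3]; cell files B-multi/KILL-draft.md v1.4 §4 (`GramPSD_k`), B-multi/PLAN.md v1.1 §9, ls-B-ref-1
REF.md (W-1), obj/EDREGISTRY.md (E-006/E-028/E-030/E-034/E-035 slots). «The programme SEARCHES and TYPES; no claim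
about Landau–Siegel zeros, Theorems 1–2 of arXiv:2211.02515 or a repaired Margin232 until a kernel theorem says so.»
-/

noncomputable section

open Complex Real Set ComplexConjugate Matrix
open scoped ComplexOrder

namespace Literature.NumberTheory.LFunctions.Zhang2022

namespace KnifeEdge

open Repair Skeleton

variable {c' : ℝ} {D : ℕ} {χ : DirichletCharacter ℂ D}

/-! ### Part 1 — Hermitian symmetry, the diagonal, finite sesquilinearity -/

/-- **Hermitian symmetry of the polar pairing:** `conj Ξ(F,G) = Ξ(G,F)` (the weights are real).
[cite: Zhang2022LandauSiegel, §2 (2.16)–(2.17)] -/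
theorem discPolar_conj_symm (F G : Chr D → ℂ → ℂ) :
    conj (discPolar c' χ F G) = discPolar c' χ G F := by
  unfold discPolar
  rw [map_sum]
  refine Finset.sum_congr rfl fun i _ => ?_
  rw [map_mul, map_mul, Complex.conj_ofReal, Complex.conj_conj]
  ring

/-- **The diagonal is the discrete mean, as a complex number:** `Ξ(F,F) = Ξ(F)` (real).
[cite: Zhang2022LandauSiegel, §2 (2.16)–(2.17)] -/
theorem discPolar_self (F : Chr D → ℂ → ℂ) :
    discPolar c' χ F F = ((discMean c' χ F : ℝ) : ℂ) := by
  unfold discPolar discMean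
  push_cast
  refine Finset.sum_congr rfl fun i _ => ?_
  rw [Complex.mul_conj, Complex.normSq_eq_norm_sq]
  push_cast
  ring

/-- **A member's value table:** the linear combination `Σ_i x_i·H_i` of finitely many piece tables `H_i` with
amplitudes `x_i` (bulk, jumps, band, Λ-blocks … of a multi-piece design). [cite: Zhang2022LandauSiegel, §2 (2.23)–(2.30)] -/
def tableComb {ι : Type*} [Fintype ι] (x : ι → ℂ) (H : ι → (Chr D → ℂ → ℂ)) : Chr D → ℂ → ℂ :=
  fun ψ s => ∑ i, x i * H i ψ s

/-- Finite sesquilinearity of a weighted Hermitian pairing of finite sums (pure algebra).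
[cite: Zhang2022LandauSiegel, §2 (2.16)–(2.17)] -/
private theorem sesq_aux {α ι κ : Type*} (s : Finset α) [Fintype ι] [Fintype κ] (w : α → ℂ)
    (a : ι → α → ℂ) (b : κ → α → ℂ) (x : ι → ℂ) (y : κ → ℂ) :
    ∑ r ∈ s, w r * ((∑ i, x i * a i r) * conj (∑ j, y j * b j r)) =
      ∑ i, ∑ j, x i * conj (y j) * ∑ r ∈ s, w r * (a i r * conj (b j r)) := by
  -- both sides equal the triple sum `∑ r, ∑ i, ∑ j, w r·x i·a i r·conj(y j)·conj(b j r)`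
  have hL : ∑ r ∈ s, w r * ((∑ i, x i * a i r) * conj (∑ j, y j * b j r)) =
      ∑ r ∈ s, ∑ i, ∑ j, w r * (x i * a i r * (conj (y j) * conj (b j r))) := by
    refine Finset.sum_congr rfl fun r _ => ?_
    rw [map_sum, Finset.sum_mul_sum, Finset.mul_sum]
    refine Finset.sum_congr rfl fun i _ => ?_
    rw [Finset.mul_sum]
    refine Finset.sum_congr rfl fun j _ => ?_
    rw [map_mul]
  have hR : ∑ i, ∑ j, x i * conj (y j) * ∑ r ∈ s, w r * (a i r * conj (b j r)) =
      ∑ r ∈ s, ∑ i, ∑ j, w r * (x i * a i r * (conj (y j) * conj (b j r))) := by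
    have h1 : ∀ i j, x i * conj (y j) * ∑ r ∈ s, w r * (a i r * conj (b j r)) =
        ∑ r ∈ s, w r * (x i * a i r * (conj (y j) * conj (b j r))) := fun i j => by
      rw [Finset.mul_sum]
      exact Finset.sum_congr rfl fun r _ => by ring
    simp_rw [h1]
    have h2 : ∀ i, ∑ j, ∑ r ∈ s, w r * (x i * a i r * (conj (y j) * conj (b j r))) =
        ∑ r ∈ s, ∑ j, w r * (x i * a i r * (conj (y j) * conj (b j r))) := fun i => Finset.sum_comm
    simp_rw [h2]
    exact Finset.sum_comm
  rw [hL, hR]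

/-- **Finite sesquilinearity of the polar pairing (one statement):**
`Ξ(Σ_i x_i H_i, Σ_j y_j K_j) = Σ_i Σ_j x_i·conj(y_j)·Ξ(H_i, K_j)`. [cite: Zhang2022LandauSiegel, §2 (2.16)–(2.17)] -/
theorem discPolar_tableComb {ι κ : Type*} [Fintype ι] [Fintype κ] (x : ι → ℂ) (y : κ → ℂ)
    (H : ι → (Chr D → ℂ → ℂ)) (K : κ → (Chr D → ℂ → ℂ)) :
    discPolar c' χ (tableComb x H) (tableComb y K) =
      ∑ i, ∑ j, x i * conj (y j) * discPolar c' χ (H i) (K j) := by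
  unfold discPolar tableComb
  exact sesq_aux (idx χ) (fun r => (((cstar c' D r.1 r.2).re * (omegaW D r.2).re : ℝ) : ℂ))
    (fun i r => H i r.1 r.2) (fun j r => K j r.1 r.2) x y

/-- **Every member's discrete mean is the Gram form of its amplitudes:**
`Ξ(Σ_i x_i H_i) = Σ_i Σ_j x_i·conj(x_j)·Ξ(H_i,H_j)` (as complex numbers; the left side is real).
[cite: Zhang2022LandauSiegel, §2 (2.16)–(2.17)] -/
theorem discMean_tableComb {ι : Type*} [Fintype ι] (x : ι → ℂ) (H : ι → (Chr D → ℂ → ℂ)) :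
    ((discMean c' χ (tableComb x H) : ℝ) : ℂ) = ∑ i, ∑ j, x i * conj (x j) * discPolar c' χ (H i) (H j) := by
  rw [← discPolar_self, discPolar_tableComb]

/-! ### Part 2 — the Gram matrix of the discrete form is PSD at every modulus -/

/-- **The Gram matrix of the discrete form** on a finite family of value tables: `G_{ij} = Ξ(H_i, H_j)`.
[cite: Zhang2022LandauSiegel, §2 (2.16)–(2.17)] -/
def discGram (c' : ℝ) (χ : DirichletCharacter ℂ D) {ι : Type*} [Fintype ι] (H : ι → (Chr D → ℂ → ℂ)) :
    Matrix ι ι ℂ :=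
  Matrix.of fun i j => discPolar c' χ (H i) (H j)

/-- Entries of the Gram matrix. [cite: Zhang2022LandauSiegel, §2 (2.16)–(2.17)] -/
@[simp] theorem discGram_apply {ι : Type*} [Fintype ι] (H : ι → (Chr D → ℂ → ℂ)) (i j : ι) :
    discGram c' χ H i j = discPolar c' χ (H i) (H j) := rfl

/-- **The Gram matrix is Hermitian** (every modulus, any weights). [cite: Zhang2022LandauSiegel, §2 (2.16)–(2.17)] -/
theorem discGram_isHermitian {ι : Type*} [Fintype ι] (H : ι → (Chr D → ℂ → ℂ)) :
    (discGram c' χ H).IsHermitian :=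
  Matrix.IsHermitian.ext fun i j => by
    rw [discGram_apply, discGram_apply, Complex.star_def, discPolar_conj_symm]

/-- **The Gram quadratic form is a diagonal value of the pairing:** `x†·G·x = Ξ(T,T)` with `T = Σ_i conj(x_i)·H_i`.
[cite: Zhang2022LandauSiegel, §2 (2.16)–(2.17)] -/
theorem star_dotProduct_discGram_mulVec {ι : Type*} [Fintype ι] (x : ι → ℂ) (H : ι → (Chr D → ℂ → ℂ)) :
    star x ⬝ᵥ (discGram c' χ H *ᵥ x) = discPolar c' χ (tableComb (star x) H) (tableComb (star x) H) := by
  rw [discPolar_tableComb]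
  simp only [dotProduct, mulVec, discGram_apply, Pi.star_apply, Complex.star_def, Complex.conj_conj,
    Finset.mul_sum]
  refine Finset.sum_congr rfl fun i _ => Finset.sum_congr rfl fun j _ => ?_
  ring

/-- **`GramPSD_k`, elementary form:** with weights `Re 𝔠*·Re ω ≥ 0` on `idx χ`, for every amplitude vector `x`
the Gram form `x†Gx` is a non-negative real: `0 ≤ Re(x†Gx)` and `Im(x†Gx) = 0` — at EVERY modulus.
[cite: Zhang2022LandauSiegel, §2 Lemma 2.3, (2.15)–(2.17)] -/
theorem discGram_quadForm_nonneg {ι : Type*} [Fintype ι]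
    (hw : ∀ i ∈ idx χ, 0 ≤ (cstar c' D i.1 i.2).re * (omegaW D i.2).re)
    (H : ι → (Chr D → ℂ → ℂ)) (x : ι → ℂ) :
    0 ≤ (star x ⬝ᵥ (discGram c' χ H *ᵥ x)).re ∧ (star x ⬝ᵥ (discGram c' χ H *ᵥ x)).im = 0 := by
  rw [star_dotProduct_discGram_mulVec, discPolar_self, Complex.ofReal_re, Complex.ofReal_im]
  exact ⟨discMean_nonneg hw _, rfl⟩

/-- **`GramPSD_k` (Mathlib form): the Gram matrix of the discrete form is positive semidefinite** at every modulus
whose weights are `≥ 0` (Lemma 2.3 + Prop. 2.2 (i)) — for ANY finite family of value tables (bulk, jumps, band,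
Λ-blocks …). `k = 2` is `KnifeEdgeWallCross.norm_sq_discPolar_le`. [cite: Zhang2022LandauSiegel, §2 Lemma 2.3, (2.15)–(2.17)] -/
theorem discGram_posSemidef {ι : Type*} [Fintype ι]
    (hw : ∀ i ∈ idx χ, 0 ≤ (cstar c' D i.1 i.2).re * (omegaW D i.2).re)
    (H : ι → (Chr D → ℂ → ℂ)) : (discGram c' χ H).PosSemidef := by
  refine Matrix.PosSemidef.of_dotProduct_mulVec_nonneg (discGram_isHermitian H) fun x => ?_
  rw [star_dotProduct_discGram_mulVec, discPolar_self]
  exact Complex.zero_le_real.2 (discMean_nonneg hw _)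

/-- **Member corollary:** with weights `≥ 0`, every member `Σ_i x_i H_i` has discrete mean `= x Gx† ≥ 0` — the
k-block (B1) slot «main-term matrix PSD ⇒ OBJ ≥ 0» is a theorem at the discrete level.
[cite: Zhang2022LandauSiegel, §2 Lemma 2.3, (2.15)–(2.17)] -/
theorem discMean_tableComb_nonneg {ι : Type*} [Fintype ι]
    (hw : ∀ i ∈ idx χ, 0 ≤ (cstar c' D i.1 i.2).re * (omegaW D i.2).re)
    (x : ι → ℂ) (H : ι → (Chr D → ℂ → ℂ)) :
    0 ≤ (∑ i, ∑ j, x i * conj (x j) * discPolar c' χ (H i) (H j)).re := by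
  rw [← discMean_tableComb, Complex.ofReal_re]
  exact discMean_nonneg hw _

/-- At a modulus `D ≥ 3` where Lemma 2.3 and Prop. 2.2 (i) hold for `χ`, the Gram matrix of ANY finite family of
value tables is PSD (the hypotheses in the manuscript's own terms). [cite: Zhang2022LandauSiegel, §2 Lemma 2.3, Prop. 2.2 (i)] -/
theorem discGram_posSemidef_of {ι : Type*} [Fintype ι] [NeZero D] (hD : 3 ≤ D)
    (h23 : ∀ x ∈ PsiOne χ, ∀ ρ ∈ zeroSet D x, (cstar c' D x ρ).im = 0 ∧ 0 ≤ (cstar c' D x ρ).re)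
    (h22 : ∀ x ∈ PsiOne χ, ∀ s ∈ prodZeroSetOmega χ x, s.re = 1 / 2) (H : ι → (Chr D → ℂ → ℂ)) :
    (discGram c' χ H).PosSemidef :=
  discGram_posSemidef (weights_nonneg_of hD h23 h22) H

end KnifeEdge

end Literature.NumberTheory.LFunctions.Zhang2022
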